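import Summits.PneNP.PneNP.Theorems.ConvexRankGatesLinAlgGateBlindSpanChainCover

/-!
# Route ConvexRankGates, crux `LinAlgGateBlind` (stmt-PneNP-10681): SG for GRANK gates of small dimension by the span cover

Support theorems for the crux (vocabulary of `Theorems/ConvexRankGatesLinAlgGateBlindDefs.lean`). Every landed
single-gate statement of the crux chain concerns the PERM half (`PERM_d`, span programs, group-order gates); the GRANK
half was only CALIBRATED (`sgGRank_forces_dc_lowerBound`, `sgAt_gRank_dc_lowerBound`: at dimension `m^c` it is
Valiant-hard). This file proves the single-gate statement `SGAt` for GRANK gates of SMALL dimension `s`, over an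
ARBITRARY field with ARBITRARY constants, by a union-bound cover of size `#𝒱(l)^{s²}`:

* `killVars_det_eq_zero_iff_of_mem_span`, `le_rank_symbolicMatrix_iff_of_mem_span` — **span reduction**: the value
  of a GRANK gate `[θ ≤ rank (K₀ + ∑_{live i} Xᵢ Kᵢ)]` depends only on the `F`-span of the live matrices `Kᵢ`:
  switching on further inputs whose matrices are linear combinations of live ones does not change any killed minor
  up to the substitution `X_j ↦ X_j + ∑_i c_{ij} X_i` (an `F`-algebra endomorphism of `F[X]`), and switching them
  off again is `killVars`;
* `sgAt_gRank_of_chain_budget` — **the span cover** (finite form of SG): the live span of a rejected graph is spanned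
  by the matrices of `≤ d² ≤ s²` live ATOMS (`exists_subset_card_le_finrank_span_eq` in `F^{d×d}`), so the rejection
  region of a `GRANK_s` term gate is covered by the all-off events `{every atom X_a with K_a ∉ W off}` for the
  REJECTING subspaces `W ⊆ F^{d×d}` spanned by the matrices of at most `s²` atoms — at most `#𝒱(l)^{s²}` events — and
  the planting theorem `sg_of_maxtermCover` gives `SGAt m (IsGRankGate s) l k q ε` under the positive budget
  `(ν·C(l,2))^t·C(m-t,k-t) ≤ ε·C(m,k)` and the fragility budget `#𝒱(l)^{s²} · (1/2)^{ν+1} · #𝒱(l) < ε`.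

The field, its size and characteristic, and the constants `K₀, Kᵢ` play no role: only the dimension enters.
Sequel (`…GRankLogWidth`): the range `s² ≤ m^{7/8}/(log₂ m)^5` at logarithmic atom width and the unconditional
circuit lower bound for `{∧₂, ∨₂} ∪ PERM_d ∪ GRANK_s`. Sources: Edmonds 1967 §5 Thm. 1 (generic rank = largest
non-vanishing minor); Razborov 1985, Alon–Boppana 1987 §3; planting theorem and chain covers are the tree's.
No new definitions. [folklore]
-/

-- `Summit.PneNP.PneNP.…` duplicates `PneNP` BY DESIGN (single-problem summit).
set_option linter.dupNamespace false

namespace Summit.PneNP.PneNP.Theorems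

open Finset Filter Literature.Computability.Complexity Razborov
open Summit.PneNP.PneNP.Cruxes.LinAlgGateBlind.DnfInvariantWideGatesSeeSmallCliques

/-! ### Span reduction: a GRANK gate reads only the span of its live matrices -/

section SpanReduction

variable {F : Type*} [Field F] {n d : ℕ}

/-- **Span reduction for killed minors.** Let `v ≤ w` be input vectors such that every matrix `K i` switched on
in `w` is an `F`-linear combination of matrices `K j` switched on in `v`. Then every killed minor of the generic
symbolic matrix `K₀ + ∑ᵢ Xᵢ Kᵢ` vanishes for `w` iff it vanishes for `v`. (`→`: kill the extra variables,
`killVars_comp`. `←`: with `K i = ∑_{v j = 1} c_{ij} K j` for the extra inputs `i`, the `F`-algebra map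
`ψ : X_j ↦ X_j + ∑_i c_{ij} X_i` sends the `v`-killed symbolic matrix to the `w`-killed one, entrywise, hence
minors to minors.) [folklore] -/
theorem killVars_det_eq_zero_iff_of_mem_span (K₀ : Matrix (Fin d) (Fin d) F)
    (K : Fin n → Matrix (Fin d) (Fin d) F) {v w : Fin n → Bool} (hvw : v ≤ w)
    (hspan : ∀ i, w i = true → K i ∈ Submodule.span F (K '' {j | v j = true}))
    {ι : Type*} [Fintype ι] [DecidableEq ι] (r c : ι → Fin d) :
    killVars w ((symbolicPolyMatrix K₀ K).submatrix r c).det = 0 ↔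
      killVars v ((symbolicPolyMatrix K₀ K).submatrix r c).det = 0 := by
  classical
  refine ⟨fun h => by rw [← killVars_comp hvw, AlgHom.comp_apply, h, map_zero], fun h => ?_⟩
  -- coefficients of the extra matrices over the `v`-live ones
  set T : Finset (Fin n) := univ.filter fun j => v j = true with hTdef
  have hc : ∀ i, ∃ cf : Fin n → F, w i = true → ∑ j ∈ T, cf j • K j = K i := by
    intro i
    by_cases hw : w i = true
    · have hset : (K '' {j | v j = true}) = K '' (T : Set (Fin n)) := by
        rw [hTdef, coe_filter]
        simp
      have hmem := hspan i hw
      rw [hset, Submodule.mem_span_image_finset_iff_exists_fun'] at hmem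
      obtain ⟨cf, hcf⟩ := hmem
      exact ⟨cf, fun _ => hcf⟩
    · exact ⟨0, fun h' => absurd h' hw⟩
  choose cf hcf using hc
  -- the extra inputs and the substitution `ψ`
  set S : Finset (Fin n) := univ.filter fun i => w i = true ∧ v i = false with hSdef
  set ψ : MvPolynomial (Fin n) F →ₐ[F] MvPolynomial (Fin n) F :=
    MvPolynomial.aeval fun j => (MvPolynomial.X j : MvPolynomial (Fin n) F) +
      ∑ i ∈ S, MvPolynomial.C (cf i j) * MvPolynomial.X i with hψdef
  have hψX : ∀ j, ψ (MvPolynomial.X j) = MvPolynomial.X j + ∑ i ∈ S, MvPolynomial.C (cf i j) * MvPolynomial.X i :=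
    fun j => MvPolynomial.aeval_X _ _
  -- entry identity from the coefficients
  have hentry : ∀ i ∈ S, ∀ a b : Fin d, ∑ j ∈ T, cf i j * K j a b = K i a b := by
    intro i hi a b
    have hw : w i = true := ((mem_filter.1 hi).2).1
    have h1 := congrArg (fun M : Matrix (Fin d) (Fin d) F => M a b) (hcf i hw)
    simpa only [Matrix.sum_apply, Matrix.smul_apply, smul_eq_mul] using h1
  -- `w`-live = `v`-live ⊔ extra
  have hsplit : (univ.filter fun i => w i = true : Finset (Fin n)) = T ∪ S := by
    ext i
    simp only [hTdef, hSdef, mem_filter, mem_univ, true_and, mem_union]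
    constructor
    · intro hw
      cases hv : v i
      · exact Or.inr ⟨hw, rfl⟩
      · exact Or.inl rfl
    · rintro (hv | ⟨hw, -⟩)
      · exact eq_true_of_le_of_eq_true (hvw i) hv
      · exact hw
  have hdisj : Disjoint T S := by
    rw [hTdef, hSdef, disjoint_filter]
    intro i _ hv h
    rw [hv] at h
    exact Bool.noConfusion h.2
  -- the key matrix identity
  have key : (symbolicPolyMatrix K₀ K).map (ψ.comp (killVars v)) =
      (symbolicPolyMatrix K₀ K).map (killVars w) := by
    refine Matrix.ext fun a b => ?_
    simp only [symbolicPolyMatrix, Matrix.map_apply, Matrix.add_apply, Matrix.sum_apply,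
      Matrix.smul_apply, smul_eq_mul, map_add, map_sum, map_mul, MvPolynomial.algHom_C,
      MvPolynomial.algebraMap_eq, AlgHom.comp_apply, killVars_X, apply_ite, map_zero, hψX, ite_mul, zero_mul]
    rw [← sum_filter, ← sum_filter, ← hTdef, hsplit, sum_union hdisj]
    simp only [add_mul, sum_add_distrib, sum_mul]
    congr 2
    rw [sum_comm]
    refine sum_congr rfl fun i hi => ?_
    calc ∑ j ∈ T, (MvPolynomial.C (cf i j) : MvPolynomial (Fin n) F) * MvPolynomial.X i * MvPolynomial.C (K j a b)
        = (MvPolynomial.X i : MvPolynomial (Fin n) F) * MvPolynomial.C (∑ j ∈ T, cf i j * K j a b) := by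
          rw [map_sum, mul_sum]
          refine sum_congr rfl fun j _ => ?_
          rw [map_mul]
          ring
      _ = (MvPolynomial.X i : MvPolynomial (Fin n) F) * MvPolynomial.C (K i a b) := by rw [hentry i hi]
  have e1 : ∀ f : MvPolynomial (Fin n) F →ₐ[F] MvPolynomial (Fin n) F,
      f ((symbolicPolyMatrix K₀ K).submatrix r c).det =
        (((symbolicPolyMatrix K₀ K).map f).submatrix r c).det := by
    intro f
    rw [AlgHom.map_det, AlgHom.mapMatrix_apply, Matrix.submatrix_map]
  rw [e1, ← key, ← e1, AlgHom.comp_apply, h, map_zero]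

/-- **Span reduction for the rank threshold.** Under the hypotheses of `killVars_det_eq_zero_iff_of_mem_span`,
`θ ≤ rank (K₀ + ∑_{w i = 1} Xᵢ Kᵢ)` iff `θ ≤ rank (K₀ + ∑_{v i = 1} Xᵢ Kᵢ)` over `Frac F[X]`: a GRANK gate reads
only the `F`-span of its live matrices (rank is witnessed by a non-zero minor, Edmonds 1967 §5 Thm. 1).
[cite: Edmonds1967, §5 Thm. 1 and §7] -/
theorem le_rank_symbolicMatrix_iff_of_mem_span (K₀ : Matrix (Fin d) (Fin d) F)
    (K : Fin n → Matrix (Fin d) (Fin d) F) {v w : Fin n → Bool} (hvw : v ≤ w)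
    (hspan : ∀ i, w i = true → K i ∈ Submodule.span F (K '' {j | v j = true})) (θ : ℕ) :
    θ ≤ (symbolicMatrix K₀ K w).rank ↔ θ ≤ (symbolicMatrix K₀ K v).rank := by
  rw [Literature.LinearAlgebra.Matrix.le_rank_iff_exists_det_submatrix_ne_zero,
    Literature.LinearAlgebra.Matrix.le_rank_iff_exists_det_submatrix_ne_zero]
  refine exists_congr fun r => exists_congr fun c => not_congr ?_
  rw [det_submatrix_symbolicMatrix_eq_zero_iff, det_submatrix_symbolicMatrix_eq_zero_iff,
    killVars_det_eq_zero_iff_of_mem_span K₀ K hvw hspan]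

end SpanReduction

/-! ### SG for GRANK gates of small dimension from the span cover -/

/-- **The span cover of a GRANK term gate (finite form of SG_GRANK).** Let `q ∈ [0,1]`, `1 - q^{C(l,2)} ≤ 1/2`,
`0 < ε`, `2t ≤ l`, and suppose the POSITIVE budget `(ν·C(l,2))^t · C(m-t, k-t) ≤ ε·C(m,k)` and the FRAGILITY budget
`#𝒱(l)^{s²} · (1/2)^{ν+1} · #𝒱(l) < ε`. Then `SGAt m (IsGRankGate s) l k q ε`: every GRANK term gate
`O(x) = [θ ≤ rank (K₀ + ∑_{⌈X_a⌉(x) = 1} X_a K_a)]` of dimension `d ≤ s` over ANY field, with atoms in `𝒱(l)`, is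
`ε`-approximated one-sidedly by a small-clique DNF. Proof: for an `s²`-tuple of atoms `f` put
`W_f = span {K_a : X_a ∈ range f} ⊆ F^{d×d}` and `w_f = [K_a ∈ W_f]_a`; a graph is rejected iff for some `f` with
`g(w_f) = 0` every atom `X_a` with `K_a ∉ W_f` is absent: (⇐) the live inputs lie inside `w_f` and `g` is monotone;
(⇒) the live span is spanned by the matrices of `≤ dim F^{d×d} = d² ≤ s²` live atoms
(`exists_subset_card_le_finrank_span_eq`), listed as `f` padded with the always-present atom `∅`; then `W_f` is the
live span and `g(w_f) = g(live) = 0` by span reduction (`le_rank_symbolicMatrix_iff_of_mem_span`). So the rejection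
region is covered by `≤ #𝒱(l)^{s²}` all-off events inside it and the planting theorem `sg_of_maxtermCover`
(`η = ε/#𝒱(l)`) concludes. [folklore] -/
theorem sgAt_gRank_of_chain_budget : ∀ (m l k s ν t : ℕ) (q ε : ℝ), 0 ≤ q → q ≤ 1 →
    1 - q ^ (l.choose 2) ≤ 1 / 2 → 0 < ε → 2 * t ≤ l →
    (((ν * l.choose 2) ^ t * (m - t).choose (k - t) : ℕ) : ℝ) ≤ ε * (m.choose k : ℝ) →
    (#(smallSets (Fin m) l) : ℝ) ^ (s * s) * (1 / 2) ^ (ν + 1) * #(smallSets (Fin m) l) < ε →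
    SGAt m (IsGRankGate s) l k q ε := by
  intro m l k s ν t q ε hq0 hq1 hql hε htl hpos hfrag O hO
  classical
  obtain ⟨g, hg, X, hX, hOX⟩ := hO
  have hmono : Monotone g.2 := hg.monotone
  obtain ⟨F, _, d, θ, hd, K₀, K, hgK⟩ := hg
  set V := smallSets (Fin m) l with hVdef
  have hV : (0 : ℝ) < #V := Nat.cast_pos.2 (card_pos.2 ⟨∅, empty_mem_smallSets l⟩)
  -- the live inputs of a graph
  set lv : (KEdge m → Bool) → Fin g.1 → Bool := fun x a => atomB (X a) x with hlv
  have hlv_iff : ∀ x a, lv x a = true ↔ CliquePresent (X a) x := fun x a => by simp [hlv, atomB]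
  -- the subspace spanned by the matrices of the atoms listed by `f`, and its indicator
  set W : (Fin (s * s) → V) → Submodule F (Matrix (Fin d) (Fin d) F) :=
    fun f => Submodule.span F (K '' {a | ∃ i, ((f i : V) : Finset (Fin m)) = X a}) with hWdef
  set wf : (Fin (s * s) → V) → Fin g.1 → Bool := fun f a => decide (K a ∈ W f) with hwf
  -- the span cover
  have hiff : ∀ x, O x = false ↔
      ∃ f : Fin (s * s) → V, g.2 (wf f) = false ∧ ∀ a, K a ∉ W f → ¬ CliquePresent (X a) x := by
    intro x
    constructor
    · intro h0
      -- few live atoms span the live span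
      obtain ⟨J, hJI, hJcard, hJ⟩ :=
        exists_subset_card_le_finrank_span_eq (F := F) K (univ.filter fun a => CliquePresent (X a) x)
      have hIset : ((univ.filter fun a => CliquePresent (X a) x : Finset (Fin g.1)) : Set (Fin g.1)) =
          {a | CliquePresent (X a) x} := by
        ext a
        simp
      rw [hIset] at hJ
      rw [Module.finrank_matrix, Fintype.card_fin, Module.finrank_self, mul_one] at hJcard
      -- the atoms of `J`, listed as an `s²`-tuple padded with `∅`
      set 𝒥 : Finset (Finset (Fin m)) := J.image X with h𝒥def
      have h𝒥V : 𝒥 ⊆ V := by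
        intro Y hY
        obtain ⟨a, -, rfl⟩ := mem_image.1 hY
        exact hX a
      have h𝒥card : #𝒥 ≤ s * s := card_image_le.trans (hJcard.trans (Nat.mul_le_mul hd hd))
      set e𝒥 := 𝒥.equivFin with he𝒥
      set f : Fin (s * s) → V := fun i =>
        if h : (i : ℕ) < #𝒥 then ⟨(e𝒥.symm ⟨i, h⟩ : Finset (Fin m)), h𝒥V (e𝒥.symm ⟨i, h⟩).2⟩
        else ⟨∅, empty_mem_smallSets l⟩ with hfdef
      have hf_live : ∀ a, (∃ i, ((f i : V) : Finset (Fin m)) = X a) → CliquePresent (X a) x := by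
        rintro a ⟨i, hi⟩
        by_cases h : (i : ℕ) < #𝒥
        · have hmem : X a ∈ 𝒥 := by
            rw [← hi, hfdef]
            simp only [h, dif_pos]
            exact (e𝒥.symm ⟨i, h⟩).2
          obtain ⟨b, hb, hba⟩ := mem_image.1 hmem
          have hb_live : CliquePresent (X b) x := (mem_filter.1 (hJI hb)).2
          rw [← hba]
          exact hb_live
        · have hempty : X a = ∅ := by
            rw [← hi, hfdef]
            simp only [h, dif_neg, not_false_eq_true]
          rw [hempty]
          exact cliquePresent_empty x
      have hJ_listed : ∀ b ∈ J, ∃ i, ((f i : V) : Finset (Fin m)) = X b := by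
        intro b hb
        have hXb : X b ∈ 𝒥 := mem_image_of_mem X hb
        refine ⟨⟨e𝒥 ⟨X b, hXb⟩, lt_of_lt_of_le (e𝒥 ⟨X b, hXb⟩).2 h𝒥card⟩, ?_⟩
        rw [hfdef]
        simp only [(e𝒥 ⟨X b, hXb⟩).2, dif_pos, Fin.eta, Equiv.symm_apply_apply]
      have hWf : W f = Submodule.span F (K '' {a | CliquePresent (X a) x}) := by
        apply le_antisymm
        · refine Submodule.span_le.2 ?_
          rintro _ ⟨a, ha, rfl⟩
          exact Submodule.subset_span ⟨a, hf_live a ha, rfl⟩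
        · rw [← hJ]
          exact Submodule.span_mono (Set.image_mono fun b hb => hJ_listed b hb)
      -- span reduction: `g (w_f) = g (live) = O x = 0`
      have hle : lv x ≤ wf f := by
        intro a ha
        rw [hwf]
        simp only [decide_eq_true_eq]
        rw [hWf]
        exact Submodule.subset_span ⟨a, (hlv_iff x a).1 ha, rfl⟩
      have hspan : ∀ a, wf f a = true → K a ∈ Submodule.span F (K '' {b | lv x b = true}) := by
        intro a ha
        have hset : {b | lv x b = true} = {b | CliquePresent (X b) x} := Set.ext fun b => hlv_iff x b
        rw [hset, ← hWf]
        simpa [hwf] using ha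
      have hrej : g.2 (wf f) = false := by
        have hOx : g.2 (lv x) = false := by rw [← hOX x]; exact h0
        have h := (hgK (wf f)).trans ((le_rank_symbolicMatrix_iff_of_mem_span K₀ K hle hspan θ).trans
          (hgK (lv x)).symm)
        rw [hOx] at h
        cases hval : g.2 (wf f)
        · rfl
        · exact absurd (h.1 hval) Bool.false_ne_true
      refine ⟨f, hrej, fun a ha hla => ha ?_⟩
      rw [hWf]
      exact Submodule.subset_span ⟨a, hla, rfl⟩
    · rintro ⟨f, hrej, hf⟩
      have hle : lv x ≤ wf f := by
        intro a ha
        rw [hwf]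
        simp only [decide_eq_true_eq]
        by_contra hK
        exact hf a hK ((hlv_iff x a).1 ha)
      have h := hmono hle
      rw [hrej] at h
      rw [hOX x]
      cases hval : g.2 (lv x)
      · rfl
      · rw [show g.2 (fun a => atomB (X a) x) = g.2 (lv x) from rfl, hval] at h
        exact absurd h (by decide)
  -- index the span cover
  set J := {f : Fin (s * s) → V // g.2 (wf f) = false} with hJ
  set N := Nat.card J with hNdef
  set e : J ≃ Fin N := Finite.equivFin J with he
  set 𝓛 : Fin N → Finset (Finset (Fin m)) :=
    fun j => (univ.filter fun a => K a ∉ W (e.symm j).1).image X with h𝓛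
  have hNle : (N : ℝ) ≤ (#V : ℝ) ^ (s * s) := by
    have h1 : N ≤ Nat.card (Fin (s * s) → V) :=
      Nat.card_le_card_of_injective (Subtype.val : J → (Fin (s * s) → V)) Subtype.val_injective
    have h2 : Nat.card (Fin (s * s) → V) = #V ^ (s * s) := by
      rw [Nat.card_eq_fintype_card, Fintype.card_fun, Fintype.card_fin, Fintype.card_coe]
    rw [h2] at h1
    exact_mod_cast h1
  have hN : (N : ℝ) * (1 / 2) ^ (ν + 1) < ε / #V := by
    rw [lt_div_iff₀ hV]
    calc (N : ℝ) * (1 / 2) ^ (ν + 1) * #V ≤ (#V : ℝ) ^ (s * s) * (1 / 2) ^ (ν + 1) * #V := by gcongr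
      _ < ε := hfrag
  have h1 : ∀ j, 𝓛 j ⊆ V := by
    intro j Y hY
    obtain ⟨a, -, rfl⟩ := mem_image.1 hY
    exact hX a
  have h2 : ∀ x, O x = false → ∃ j, ∀ Y ∈ 𝓛 j, ¬ CliquePresent Y x := by
    intro x hx
    obtain ⟨f, hrej, hf⟩ := (hiff x).1 hx
    refine ⟨e ⟨f, hrej⟩, fun Y hY => ?_⟩
    obtain ⟨a, ha, rfl⟩ := mem_image.1 hY
    rw [mem_filter, Equiv.symm_apply_apply] at ha
    exact hf a ha.2
  have h3 : ∀ j x, (∀ Y ∈ 𝓛 j, ¬ CliquePresent Y x) → O x = false := fun j x hall =>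
    (hiff x).2 ⟨(e.symm j).1, (e.symm j).2, fun a ha =>
      hall (X a) (mem_image_of_mem X (mem_filter.2 ⟨mem_univ a, ha⟩))⟩
  obtain ⟨𝒜, h𝒜, hP, hNg⟩ := sg_of_maxtermCover m l k N ν t q (ε / #V) O 𝓛 h1 h2 h3
    hq0 hq1 hql (div_pos hε hV) hN htl
  refine ⟨𝒜, h𝒜, ?_, hNg.trans_eq (mul_div_cancel₀ ε hV.ne')⟩
  calc (#(lostPos m k O 𝒜) : ℝ) ≤ (((ν * l.choose 2) ^ t * (m - t).choose (k - t) : ℕ) : ℝ) := by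
        exact_mod_cast hP
    _ ≤ ε * (m.choose k : ℝ) := hpos

end Summit.PneNP.PneNP.Theorems
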